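import Summits.Ventures.PercRepro.CrossTwo
import Summits.Ventures.PercRepro.ForceSetA

/-!
# Conditioning on an edge set, part B (p6, gen 4; split for the 400-line lint)

Continuation of `ForceSetA.lean`: `law4/deltaVec/deltaQuad_eq_sum_forcePat`, `nestedSum`, `nestedSum_diag`,
**`deltaQuad_eq_sum_nested`**, `deltaQuad_nonpos_of_nested`, `amgm_triple`, `patWeight_split`,
**`deltaQuad_nonpos_of_split`**, **`deltaQuad_nonpos_of_repairs`**.
-/

namespace PercRepro
open Finset


section Law

namespace MultiGraph

variable {V E : Type*} (G : MultiGraph V E) [Fintype E] [DecidableEq E]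

/-- The law is the mixture of the forced laws. -/
theorem law4_eq_sum_forcePat (p : E → ℝ) (S : Finset E) (a b c d : V) (s : Fin 15) :
    G.law4 p a b c d s = ∑ A ∈ S.powerset, patWeight p S A * G.law4 (forcePat p S A) a b c d s := by
  unfold law4
  exact prob_eq_sum_forcePat p _ S

/-- `Δ_g` is the mixture of the forced `Δ_g`'s (`g ∉ S`). -/
theorem deltaVec_eq_sum_forcePat (p : E → ℝ) {S : Finset E} {g : E} (hg : g ∉ S) (a b c d : V) :
    G.deltaVec p g a b c d = fun s =>
      ∑ A ∈ S.powerset, patWeight p S A * G.deltaVec (forcePat p S A) g a b c d s := by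
  funext s
  simp only [deltaVec]
  rw [G.law4_eq_sum_forcePat (Function.update p g 1) S, G.law4_eq_sum_forcePat (Function.update p g 0) S,
    ← Finset.sum_sub_distrib]
  refine Finset.sum_congr rfl fun A _ => ?_
  rw [patWeight_update_of_notMem p hg, patWeight_update_of_notMem p hg,
    forcePat_update_of_notMem p hg, forcePat_update_of_notMem p hg]
  ring

/-- **The `S`-fibre decomposition of `Q⁺(Δ_g, Δ_g)`** (`g ∉ S`):
`Q⁺(Δ_g, Δ_g) = Σ_{A, A′ ⊆ S} w(A) w(A′) Q⁺(Δ_A, Δ_{A′})` with `Δ_A` the forced `Δ_g`. -/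
theorem deltaQuad_eq_sum_forcePat (p : E → ℝ) {S : Finset E} {g : E} (hg : g ∉ S) (a b c d : V) :
    G.deltaQuad p g a b c d = ∑ A ∈ S.powerset, ∑ A' ∈ S.powerset,
      patWeight p S A * patWeight p S A' *
        quadPlus (G.deltaVec (forcePat p S A) g a b c d) (G.deltaVec (forcePat p S A') g a b c d) := by
  rw [G.deltaQuad_eq_quadPlus_deltaVec, G.deltaVec_eq_sum_forcePat p hg]
  exact quadPlus_sum_sum _ _ _

/-- **The nested sum `N_S(I, U)`**: the sum of `Q⁺(Δ_A, Δ_{A′})` over the ordered pairs of patterns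
with `A ∩ A′ = I` and `A ∪ A′ = U` (`I` = sure on both copies, `U ∖ I` = differing, `S ∖ U` = closed). -/
noncomputable def nestedSum (p : E → ℝ) (S : Finset E) (g : E) (a b c d : V) (I U : Finset E) : ℝ :=
  ∑ AA ∈ (S.powerset ×ˢ S.powerset).filter
      (fun AA : Finset E × Finset E => (AA.1 ∩ AA.2, AA.1 ∪ AA.2) = (I, U)),
    quadPlus (G.deltaVec (forcePat p S AA.1) g a b c d) (G.deltaVec (forcePat p S AA.2) g a b c d)

/-- A diagonal nested sum is the slack of the forced minor: `N_S(J, J) = Q⁺(Δ_J, Δ_J)`. -/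
theorem nestedSum_diag (p : E → ℝ) (S : Finset E) (g : E) (a b c d : V) {J : Finset E}
    (hJ : J ⊆ S) :
    G.nestedSum p S g a b c d J J = G.deltaQuad (forcePat p S J) g a b c d := by
  unfold nestedSum
  rw [G.deltaQuad_eq_quadPlus_deltaVec, Finset.sum_eq_single (J, J)]
  · intro AA hAA hne
    exfalso
    have h := (Finset.mem_filter.mp hAA).2
    simp only [Prod.mk.injEq] at h
    apply hne
    have h1 : AA.1 ⊆ AA.2 :=
      calc AA.1 ⊆ AA.1 ∪ AA.2 := Finset.subset_union_left
        _ = J := h.2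
        _ = AA.1 ∩ AA.2 := h.1.symm
        _ ⊆ AA.2 := Finset.inter_subset_right
    have h2 : AA.2 ⊆ AA.1 :=
      calc AA.2 ⊆ AA.1 ∪ AA.2 := Finset.subset_union_right
        _ = J := h.2
        _ = AA.1 ∩ AA.2 := h.1.symm
        _ ⊆ AA.1 := Finset.inter_subset_left
    have : AA.1 = AA.2 := Finset.Subset.antisymm h1 h2
    have hJ1 : AA.1 = J := by rw [← h.1, this, Finset.inter_self]
    exact Prod.ext hJ1 (this ▸ hJ1)
  · intro hnot
    exfalso
    apply hnot
    refine Finset.mem_filter.mpr ⟨Finset.mem_product.mpr ⟨Finset.mem_powerset.mpr hJ, Finset.mem_powerset.mpr hJ⟩, ?_⟩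
    simp

/-- **Regrouping by nested pairs** (log-modularity of the pattern weights):
`Q⁺(Δ_g, Δ_g) = Σ_{(I, U)} w(I) w(U) · N_S(I, U)`. -/
theorem deltaQuad_eq_sum_nested (p : E → ℝ) {S : Finset E} {g : E} (hg : g ∉ S) (a b c d : V) :
    G.deltaQuad p g a b c d = ∑ IU ∈ S.powerset ×ˢ S.powerset,
      patWeight p S IU.1 * patWeight p S IU.2 * G.nestedSum p S g a b c d IU.1 IU.2 := by
  rw [G.deltaQuad_eq_sum_forcePat p hg, ← Finset.sum_product']
  have hmaps : ∀ AA ∈ S.powerset ×ˢ S.powerset,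
      (fun AA : Finset E × Finset E => (AA.1 ∩ AA.2, AA.1 ∪ AA.2)) AA ∈ S.powerset ×ˢ S.powerset := by
    intro AA hAA
    obtain ⟨h1, h2⟩ := Finset.mem_product.mp hAA
    exact Finset.mem_product.mpr ⟨Finset.mem_powerset.mpr
      (Finset.inter_subset_left.trans (Finset.mem_powerset.mp h1)),
      Finset.mem_powerset.mpr (Finset.union_subset (Finset.mem_powerset.mp h1)
        (Finset.mem_powerset.mp h2))⟩
  rw [← Finset.sum_fiberwise_of_maps_to hmaps]
  refine Finset.sum_congr rfl fun IU _ => ?_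
  unfold nestedSum
  rw [Finset.mul_sum]
  refine Finset.sum_congr rfl fun AA hAA => ?_
  have h := (Finset.mem_filter.mp hAA).2
  simp only [Prod.mk.injEq] at h
  rw [patWeight_mul_patWeight, h.1, h.2]

/-- **Lemma 5 from nonpositive nested sums**: if every `N_S(I, U) ≤ 0` then `Q⁺(Δ_g, Δ_g) ≤ 0`
(the `S`-fibre Bernstein certificate; `S = E ∖ {g}` is typer-2's `ClassSumNonneg`). -/
theorem deltaQuad_nonpos_of_nested {p : E → ℝ} (hp : IsProb p) {S : Finset E} {g : E} (hg : g ∉ S)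
    (a b c d : V) (h : ∀ I ∈ S.powerset, ∀ U ∈ S.powerset, G.nestedSum p S g a b c d I U ≤ 0) :
    G.deltaQuad p g a b c d ≤ 0 := by
  rw [G.deltaQuad_eq_sum_nested p hg]
  refine Finset.sum_nonpos fun IU hIU => ?_
  obtain ⟨h1, h2⟩ := Finset.mem_product.mp hIU
  exact mul_nonpos_of_nonneg_of_nonpos
    (mul_nonneg (patWeight_nonneg hp _ _) (patWeight_nonneg hp _ _)) (h _ h1 _ h2)

/-- **The three-term AM-GM** behind the split discriminant: weights `w₁ w₂ = w²`, two nonpositive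
terms and one positive term with `N² ≤ 4 N₁ N₂` sum to `≤ 0`. -/
theorem amgm_triple {w w₁ w₂ N N₁ N₂ : ℝ} (hw₁ : 0 ≤ w₁) (hw₂ : 0 ≤ w₂)
    (hww : w₁ * w₂ = w ^ 2) (hN₁ : N₁ ≤ 0) (hN₂ : N₂ ≤ 0) (hdisc : N ^ 2 ≤ 4 * N₁ * N₂) :
    w₁ * N₁ + w₂ * N₂ + w * N ≤ 0 := by
  -- `(w₁ N₁ + w₂ N₂)² ≥ 4 w₁ w₂ N₁ N₂ = 4 w² N₁ N₂ ≥ w² N²`, and `w₁ N₁ + w₂ N₂ ≤ 0`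
  have hsum : w₁ * N₁ + w₂ * N₂ ≤ 0 := by nlinarith [mul_nonneg hw₁ (neg_nonneg.mpr hN₁), mul_nonneg hw₂ (neg_nonneg.mpr hN₂)]
  have hsq : (w * N) ^ 2 ≤ (w₁ * N₁ + w₂ * N₂) ^ 2 := by
    have h1 : (w * N) ^ 2 = w ^ 2 * N ^ 2 := by ring
    have h2 : w ^ 2 * N ^ 2 ≤ w ^ 2 * (4 * N₁ * N₂) := mul_le_mul_of_nonneg_left hdisc (sq_nonneg w)
    have h3 : w ^ 2 * (4 * N₁ * N₂) = 4 * (w₁ * w₂) * (N₁ * N₂) := by rw [hww]; ring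
    have h4 : 4 * (w₁ * w₂) * (N₁ * N₂) ≤ (w₁ * N₁ + w₂ * N₂) ^ 2 := by
      nlinarith [sq_nonneg (w₁ * N₁ - w₂ * N₂)]
    linarith
  have hsq' : (w * N) ^ 2 ≤ (-(w₁ * N₁ + w₂ * N₂)) ^ 2 := by rw [neg_sq]; exact hsq
  have := abs_le_of_sq_le_sq' hsq' (by linarith)
  linarith [this.2]

omit [Fintype E] in
/-- The weight of a nested class against its two split partners: `w(J₁)² · w(J₂)² = (w(I) w(U))²`
when `J₁ ∩ J₂ = I` and `J₁ ∪ J₂ = U`. -/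
theorem patWeight_split (p : E → ℝ) (S : Finset E) {I U J₁ J₂ : Finset E} (h1 : J₁ ∩ J₂ = I)
    (h2 : J₁ ∪ J₂ = U) :
    (patWeight p S J₁ * patWeight p S J₁) * (patWeight p S J₂ * patWeight p S J₂) =
      (patWeight p S I * patWeight p S U) ^ 2 := by
  rw [← h1, ← h2, ← patWeight_mul_patWeight]
  ring

/-- **Lemma 5 from ONE split repair** (the gadget's case with `S = {a–H, v–m₂, v–H}`): all nested sums
are `≤ 0` except one class `(I, U)`, whose two diagonal partners `(J₁, J₁)`, `(J₂, J₂)` with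
`J₁ ∩ J₂ = I`, `J₁ ∪ J₂ = U` satisfy the discriminant `N(I,U)² ≤ 4 N(J₁,J₁) N(J₂,J₂)`. -/
theorem deltaQuad_nonpos_of_split {p : E → ℝ} (hp : IsProb p) {S : Finset E} {g : E} (hg : g ∉ S)
    (a b c d : V) {I U J₁ J₂ : Finset E} (hJ₁ : J₁ ⊆ S) (hJ₂ : J₂ ⊆ S) (h1 : J₁ ∩ J₂ = I)
    (h2 : J₁ ∪ J₂ = U) (hne₁ : (J₁, J₁) ≠ (I, U)) (hne₂ : (J₂, J₂) ≠ (I, U)) (hne₃ : J₁ ≠ J₂)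
    (hD₁ : G.nestedSum p S g a b c d J₁ J₁ ≤ 0) (hD₂ : G.nestedSum p S g a b c d J₂ J₂ ≤ 0)
    (hdisc : (G.nestedSum p S g a b c d I U) ^ 2 ≤
      4 * G.nestedSum p S g a b c d J₁ J₁ * G.nestedSum p S g a b c d J₂ J₂)
    (hothers : ∀ IU ∈ S.powerset ×ˢ S.powerset, IU ≠ (I, U) → IU ≠ (J₁, J₁) → IU ≠ (J₂, J₂) →
      G.nestedSum p S g a b c d IU.1 IU.2 ≤ 0) :
    G.deltaQuad p g a b c d ≤ 0 := by
  rw [G.deltaQuad_eq_sum_nested p hg]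
  have hI : I ⊆ S := h1 ▸ Finset.inter_subset_left.trans hJ₁
  have hU : U ⊆ S := h2 ▸ Finset.union_subset hJ₁ hJ₂
  have hmemIU : (I, U) ∈ S.powerset ×ˢ S.powerset :=
    Finset.mem_product.mpr ⟨Finset.mem_powerset.mpr hI, Finset.mem_powerset.mpr hU⟩
  have hmem₁ : (J₁, J₁) ∈ (S.powerset ×ˢ S.powerset).erase (I, U) :=
    Finset.mem_erase.mpr ⟨hne₁,
      Finset.mem_product.mpr ⟨Finset.mem_powerset.mpr hJ₁, Finset.mem_powerset.mpr hJ₁⟩⟩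
  have hmem₂ : (J₂, J₂) ∈ ((S.powerset ×ˢ S.powerset).erase (I, U)).erase (J₁, J₁) :=
    Finset.mem_erase.mpr ⟨show (J₂, J₂) ≠ (J₁, J₁) from fun h => hne₃ (Prod.mk.inj h).1.symm,
      Finset.mem_erase.mpr ⟨hne₂,
        Finset.mem_product.mpr ⟨Finset.mem_powerset.mpr hJ₂, Finset.mem_powerset.mpr hJ₂⟩⟩⟩
  -- peel the three special terms off the sum
  rw [← Finset.add_sum_erase _ _ hmemIU, ← Finset.add_sum_erase _ _ hmem₁,
    ← Finset.add_sum_erase _ _ hmem₂]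
  have hrest : ∑ IU ∈ (((S.powerset ×ˢ S.powerset).erase (I, U)).erase (J₁, J₁)).erase (J₂, J₂),
      patWeight p S IU.1 * patWeight p S IU.2 * G.nestedSum p S g a b c d IU.1 IU.2 ≤ 0 := by
    refine Finset.sum_nonpos fun IU hIU => ?_
    have h := Finset.mem_erase.mp hIU
    have h' := Finset.mem_erase.mp h.2
    have h'' := Finset.mem_erase.mp h'.2
    exact mul_nonpos_of_nonneg_of_nonpos
      (mul_nonneg (patWeight_nonneg hp _ _) (patWeight_nonneg hp _ _))
      (hothers IU h''.2 h''.1 h'.1 h.1)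
  have htriple := amgm_triple (w := patWeight p S I * patWeight p S U)
    (w₁ := patWeight p S J₁ * patWeight p S J₁) (w₂ := patWeight p S J₂ * patWeight p S J₂)
    (N := G.nestedSum p S g a b c d I U) (N₁ := G.nestedSum p S g a b c d J₁ J₁)
    (N₂ := G.nestedSum p S g a b c d J₂ J₂)
    (mul_nonneg (patWeight_nonneg hp _ _) (patWeight_nonneg hp _ _))
    (mul_nonneg (patWeight_nonneg hp _ _) (patWeight_nonneg hp _ _))
    (patWeight_split p S h1 h2) hD₁ hD₂ hdisc
  dsimp only
  linarith [hrest, htriple]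

/-- **Lemma 5 from a FAMILY of split repairs with sharing.** `neg` = the negative nested classes,
each with partners `(J₁ C, J₂ C)` (`J₁ ∩ J₂ = I`, `J₁ ∪ J₂ = U`), and a share `sh C J ∈ [0, ∞)` of the
diagonal class `(J, J)` allotted to `C`, with total allotment `≤ 1` on every diagonal class; the
discriminant of each negative class is taken against its SHARES of the two partners; every class
outside `neg` (diagonal or not) has a nonpositive nested sum. Then the slack is `≤ 0`. -/
theorem deltaQuad_nonpos_of_repairs {p : E → ℝ} (hp : IsProb p) {S : Finset E} {g : E} (hg : g ∉ S)
    (a b c d : V) (neg : Finset (Finset E × Finset E)) (hneg : neg ⊆ S.powerset ×ˢ S.powerset)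
    (J₁ J₂ : Finset E × Finset E → Finset E) (sh : Finset E × Finset E → Finset E → ℝ)
    (hJ : ∀ C ∈ neg, J₁ C ∩ J₂ C = C.1 ∧ J₁ C ∪ J₂ C = C.2 ∧ J₁ C ⊆ S ∧ J₂ C ⊆ S)
    (hsh : ∀ C J, 0 ≤ sh C J)
    (htot : ∀ J ∈ S.powerset, ∑ C ∈ neg, sh C J ≤ 1)
    (hdiag : ∀ J ∈ S.powerset, G.nestedSum p S g a b c d J J ≤ 0)
    (hnd : ∀ C ∈ neg, C.1 ≠ C.2)
    (hdisc : ∀ C ∈ neg, (G.nestedSum p S g a b c d C.1 C.2) ^ 2 ≤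
      4 * (sh C (J₁ C) * G.nestedSum p S g a b c d (J₁ C) (J₁ C)) *
        (sh C (J₂ C) * G.nestedSum p S g a b c d (J₂ C) (J₂ C)))
    (hothers : ∀ IU ∈ S.powerset ×ˢ S.powerset, IU ∉ neg → IU.1 ≠ IU.2 →
      G.nestedSum p S g a b c d IU.1 IU.2 ≤ 0) :
    G.deltaQuad p g a b c d ≤ 0 := by
  rw [G.deltaQuad_eq_sum_nested p hg]
  -- split the index set into the diagonal `D`, the negative classes `neg`, and the rest
  set P := S.powerset ×ˢ S.powerset with hP
  set f : Finset E × Finset E → ℝ := fun IU =>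
    patWeight p S IU.1 * patWeight p S IU.2 * G.nestedSum p S g a b c d IU.1 IU.2 with hf
  have hw : ∀ IU : Finset E × Finset E, 0 ≤ patWeight p S IU.1 * patWeight p S IU.2 :=
    fun IU => mul_nonneg (patWeight_nonneg hp _ _) (patWeight_nonneg hp _ _)
  set D := P.filter (fun IU : Finset E × Finset E => IU.1 = IU.2) with hD
  have hnegD : Disjoint neg D := by
    rw [Finset.disjoint_left]
    intro C hC hCD
    exact hnd C hC (Finset.mem_filter.mp hCD).2
  have hsub : neg ∪ D ⊆ P := Finset.union_subset hneg (Finset.filter_subset _ _)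
  -- Σ_P f = Σ_neg f + Σ_D f + Σ_{P ∖ (neg ∪ D)} f
  rw [← Finset.sum_sdiff hsub, Finset.sum_union hnegD]
  -- the rest is ≤ 0
  have hrest : ∑ IU ∈ P \ (neg ∪ D), f IU ≤ 0 := by
    refine Finset.sum_nonpos fun IU hIU => ?_
    have h1 := Finset.mem_sdiff.mp hIU
    have hn : IU ∉ neg := fun h => h1.2 (Finset.mem_union_left _ h)
    have hnd' : IU.1 ≠ IU.2 := fun h => h1.2 (Finset.mem_union_right _ (Finset.mem_filter.mpr ⟨h1.1, h⟩))
    exact mul_nonpos_of_nonneg_of_nonpos (hw IU) (hothers IU h1.1 hn hnd')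
  -- the diagonal: each `(J, J)` splits into the shares given to the negative classes and a leftover
  have hdiagsum : ∑ IU ∈ D, f IU =
      ∑ IU ∈ D, (1 - ∑ C ∈ neg, sh C IU.1) * f IU + ∑ C ∈ neg, ∑ IU ∈ D, sh C IU.1 * f IU := by
    rw [Finset.sum_comm (s := neg)]
    rw [← Finset.sum_add_distrib]
    refine Finset.sum_congr rfl fun IU _ => ?_
    rw [← Finset.sum_mul]
    ring
  -- the leftover part of the diagonal is ≤ 0
  have hleft : ∑ IU ∈ D, (1 - ∑ C ∈ neg, sh C IU.1) * f IU ≤ 0 := by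
    refine Finset.sum_nonpos fun IU hIU => ?_
    have hm := Finset.mem_filter.mp hIU
    have hJ' : IU.1 ∈ S.powerset := (Finset.mem_product.mp hm.1).1
    refine mul_nonpos_of_nonneg_of_nonpos (by linarith [htot IU.1 hJ']) ?_
    have : IU = (IU.1, IU.1) := Prod.ext rfl hm.2.symm
    rw [this]
    exact mul_nonpos_of_nonneg_of_nonpos (hw _) (hdiag _ hJ')
  -- each negative class with its shares of its two partners is ≤ 0 (three-term AM-GM)
  have hnegsum : ∑ C ∈ neg, f C + ∑ C ∈ neg, ∑ IU ∈ D, sh C IU.1 * f IU ≤ 0 := by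
    rw [← Finset.sum_add_distrib]
    refine Finset.sum_nonpos fun C hC => ?_
    obtain ⟨h1, h2, hJ₁S, hJ₂S⟩ := hJ C hC
    have hmem₁ : (J₁ C, J₁ C) ∈ D := Finset.mem_filter.mpr
      ⟨Finset.mem_product.mpr ⟨Finset.mem_powerset.mpr hJ₁S, Finset.mem_powerset.mpr hJ₁S⟩, rfl⟩
    have hmem₂ : (J₂ C, J₂ C) ∈ D := Finset.mem_filter.mpr
      ⟨Finset.mem_product.mpr ⟨Finset.mem_powerset.mpr hJ₂S, Finset.mem_powerset.mpr hJ₂S⟩, rfl⟩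
    have hne : (J₁ C, J₁ C) ≠ (J₂ C, J₂ C) := by
      intro h
      have : J₁ C = J₂ C := (Prod.mk.inj h).1
      exact hnd C hC (by rw [← h1, ← h2, this, Finset.inter_self, Finset.union_self])
    -- the other diagonal shares of `C` are ≤ 0
    have hother : ∑ IU ∈ (D.erase (J₁ C, J₁ C)).erase (J₂ C, J₂ C), sh C IU.1 * f IU ≤ 0 := by
      refine Finset.sum_nonpos fun IU hIU => ?_
      have hm := Finset.mem_filter.mp (Finset.mem_erase.mp (Finset.mem_erase.mp hIU).2).2
      have hJ' : IU.1 ∈ S.powerset := (Finset.mem_product.mp hm.1).1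
      have : IU = (IU.1, IU.1) := Prod.ext rfl hm.2.symm
      refine mul_nonpos_of_nonneg_of_nonpos (hsh C _) ?_
      rw [this]
      exact mul_nonpos_of_nonneg_of_nonpos (hw _) (hdiag _ hJ')
    rw [← Finset.add_sum_erase _ _ hmem₁,
      ← Finset.add_sum_erase _ _ (Finset.mem_erase.mpr ⟨hne.symm, hmem₂⟩)]
    have hamgm := amgm_triple (w := patWeight p S C.1 * patWeight p S C.2)
      (w₁ := patWeight p S (J₁ C) * patWeight p S (J₁ C))
      (w₂ := patWeight p S (J₂ C) * patWeight p S (J₂ C))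
      (N := G.nestedSum p S g a b c d C.1 C.2)
      (N₁ := sh C (J₁ C) * G.nestedSum p S g a b c d (J₁ C) (J₁ C))
      (N₂ := sh C (J₂ C) * G.nestedSum p S g a b c d (J₂ C) (J₂ C))
      (mul_nonneg (patWeight_nonneg hp _ _) (patWeight_nonneg hp _ _))
      (mul_nonneg (patWeight_nonneg hp _ _) (patWeight_nonneg hp _ _))
      (patWeight_split p S h1 h2)
      (mul_nonpos_of_nonneg_of_nonpos (hsh _ _) (hdiag _ (Finset.mem_powerset.mpr hJ₁S)))
      (mul_nonpos_of_nonneg_of_nonpos (hsh _ _) (hdiag _ (Finset.mem_powerset.mpr hJ₂S)))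
      (hdisc C hC)
    have e0 : f C = patWeight p S C.1 * patWeight p S C.2 * G.nestedSum p S g a b c d C.1 C.2 := rfl
    have e1 : sh C (J₁ C, J₁ C).1 * f (J₁ C, J₁ C) =
        (patWeight p S (J₁ C) * patWeight p S (J₁ C)) *
          (sh C (J₁ C) * G.nestedSum p S g a b c d (J₁ C) (J₁ C)) := by
      simp only [hf]; ring
    have e2 : sh C (J₂ C, J₂ C).1 * f (J₂ C, J₂ C) =
        (patWeight p S (J₂ C) * patWeight p S (J₂ C)) *
          (sh C (J₂ C) * G.nestedSum p S g a b c d (J₂ C) (J₂ C)) := by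
      simp only [hf]; ring
    linarith [hamgm, hother, e0, e1, e2]
  rw [hdiagsum]
  linarith [hrest, hleft, hnegsum]

end MultiGraph

end Law

end PercRepro

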